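import Mathlib
import HarnessLib
import Literature.MathematicalPhysics.QuantumLattice.KohnLuttinger

/-!
# `stub_klMeanZero`: channel states of a non-trivial irrep have vanishing mean

Pure measure theory.  Let `σ = fermiCurveMeasure ε μ` be finite and invariant under each of the
eight maps `d4Momentum γ`, `γ ∈ D₄`.  A channel state `ψ` of the irrep `χ` satisfies the pointwise
identity `ψ = P_χ ψ = (dim χ / 8) ∑_γ χ(γ) ψ ∘ γ`; integrating and using `∫ ψ ∘ γ dσ = ∫ ψ dσ`
gives `∫ψ = (dim χ / 8) (∑_γ χ(γ)) ∫ψ`, and `∑_γ χ(γ) = 0` for `χ ≠ A1g` (orthogonality of `χ` to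
the trivial character, checked on the character table).
-/

noncomputable section

set_option linter.dupNamespace false

namespace Summit.HubbardSuperconductivity.HubbardSuperconductivity.Theorems

open MeasureTheory Literature.MathematicalPhysics.QuantumLattice

/-- Orthogonality of a non-trivial irreducible character of `D₄` to the trivial one:
`∑_{γ ∈ D₄} χ(γ) = 0` for `χ ≠ A1g` (read off the character table). [folklore] -/
theorem kl_mz_sum_char (χ : D4Irrep) (hχ : χ ≠ D4Irrep.A1g) :
    ∑ γ : DihedralGroup 4, χ.char γ = 0 := by
  -- expand the sum over `D₄ ≃ ZMod 4 ⊕ ZMod 4` into its eight terms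
  -- (adapted from Cruxes/CwKLChiralWindow/Disproof.lean §B `sum_d4`)
  have hsum : ∀ f : DihedralGroup 4 → ℝ, ∑ γ, f γ =
      (f (.r 0) + f (.r 1) + f (.r 2) + f (.r 3)) +
        (f (.sr 0) + f (.sr 1) + f (.sr 2) + f (.sr 3)) := by
    intro f
    rw [Fintype.sum_equiv DihedralGroup.equivSum f (fun x => f (DihedralGroup.equivSum.symm x))
      (by intro a; rcases a with j | j <;> rfl)]
    rw [Fintype.sum_sum_type]
    simp only [DihedralGroup.equivSum_symm_apply]
    have h4 : ∀ g : ZMod 4 → ℝ, ∑ i, g i = g 0 + g 1 + g 2 + g 3 := fun g => Fin.sum_univ_four g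
    rw [h4, h4]
  rw [hsum]
  cases χ with
  | A1g => exact absurd rfl hχ
  | A2g => simp only [D4Irrep.char]; norm_num
  | B1g =>
    have val0 : (0 : ZMod 4).val = 0 := rfl
    have val1 : (1 : ZMod 4).val = 1 := rfl
    have val2 : (2 : ZMod 4).val = 2 := rfl
    have val3 : (3 : ZMod 4).val = 3 := rfl
    simp only [D4Irrep.char, val0, val1, val2, val3]
    norm_num
  | B2g =>
    have val0 : (0 : ZMod 4).val = 0 := rfl
    have val1 : (1 : ZMod 4).val = 1 := rfl
    have val2 : (2 : ZMod 4).val = 2 := rfl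
    have val3 : (3 : ZMod 4).val = 3 := rfl
    simp only [D4Irrep.char, val0, val1, val2, val3]
    norm_num
  | E =>
    have ne10 : (1 : ZMod 4) ≠ 0 := by decide
    have ne12 : (1 : ZMod 4) ≠ 2 := by decide
    have ne20 : (2 : ZMod 4) ≠ 0 := by decide
    have ne30 : (3 : ZMod 4) ≠ 0 := by decide
    have ne32 : (3 : ZMod 4) ≠ 2 := by decide
    simp only [D4Irrep.char, ne10, ne12, ne20, ne30, ne32, if_true, if_false]
    norm_num

/-- Change of variables under a measure-preserving self-map (no injectivity needed):
`∫ ψ ∘ φ dσ = ∫ ψ dσ`. [folklore] -/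
theorem kl_mz_integral_comp {σ : Measure Momentum} {φ : Momentum → Momentum}
    (hφ : MeasurePreserving φ σ σ) {ψ : Momentum → ℝ} (hψ : AEStronglyMeasurable ψ σ) :
    ∫ k, ψ (φ k) ∂σ = ∫ k, ψ k ∂σ := by
  have h1 : AEStronglyMeasurable ψ (Measure.map φ σ) := by rw [hφ.map_eq]; exact hψ
  calc ∫ k, ψ (φ k) ∂σ = ∫ k, ψ k ∂(Measure.map φ σ) :=
        (integral_map hφ.measurable.aemeasurable h1).symm
    _ = ∫ k, ψ k ∂σ := by rw [hφ.map_eq]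

/-- **Stub `stub_klMeanZero`**: on a finite, `D₄`-invariant Fermi-curve measure every channel state
of a non-trivial irrep `χ ≠ A1g` is integrable and has vanishing mean `∫ψ dσ = 0`
(`ψ = P_χ ψ`, `∫ψ∘γ dσ = ∫ψ dσ`, `∑_γ χ(γ) = 0`). [folklore] -/
theorem stub_klMeanZero :
    ∀ (ε : Momentum → ℝ) (μ : ℝ), IsFiniteMeasure (fermiCurveMeasure ε μ) →
      (∀ γ : DihedralGroup 4, MeasurePreserving (d4Momentum γ) (fermiCurveMeasure ε μ) (fermiCurveMeasure ε μ)) →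
      ∀ (χ : D4Irrep) (ψ : Momentum → ℝ), χ ≠ D4Irrep.A1g → IsChannelState ε μ χ ψ →
        Integrable ψ (fermiCurveMeasure ε μ) ∧ ∫ k, ψ k ∂fermiCurveMeasure ε μ = 0 := by
  intro ε μ hfin hinv χ ψ hχ hψ
  set σ := fermiCurveMeasure ε μ with hσ
  haveI : IsFiniteMeasure σ := hfin
  have hint : Integrable ψ σ := hψ.1.integrable one_le_two
  refine ⟨hint, ?_⟩
  have hchan : d4Project χ ψ = ψ := hψ.2.2
  have hcomp : ∀ γ : DihedralGroup 4, Integrable (fun k => ψ (d4Momentum γ k)) σ :=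
    fun γ => (hinv γ).integrable_comp_of_integrable hint
  have hI : ∀ γ : DihedralGroup 4, ∫ k, ψ (d4Momentum γ k) ∂σ = ∫ k, ψ k ∂σ :=
    fun γ => kl_mz_integral_comp (hinv γ) hint.aestronglyMeasurable
  have key : ∫ k, ψ k ∂σ =
      (χ.dim / 8 : ℝ) * ((∑ γ : DihedralGroup 4, χ.char γ) * ∫ k, ψ k ∂σ) := by
    calc ∫ k, ψ k ∂σ = ∫ k, d4Project χ ψ k ∂σ := by rw [hchan]
      _ = ∫ k, (χ.dim / 8 : ℝ) * ∑ γ : DihedralGroup 4, χ.char γ * ψ (d4Momentum γ k) ∂σ := rfl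
      _ = (χ.dim / 8 : ℝ) * ∑ γ : DihedralGroup 4, ∫ k, χ.char γ * ψ (d4Momentum γ k) ∂σ := by
          rw [integral_const_mul, integral_finsetSum]
          exact fun γ _ => (hcomp γ).const_mul (χ.char γ)
      _ = (χ.dim / 8 : ℝ) * ∑ γ : DihedralGroup 4, χ.char γ * ∫ k, ψ k ∂σ := by
          congr 1
          refine Finset.sum_congr rfl fun γ _ => ?_
          rw [integral_const_mul, hI γ]
      _ = (χ.dim / 8 : ℝ) * ((∑ γ : DihedralGroup 4, χ.char γ) * ∫ k, ψ k ∂σ) := by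
          rw [Finset.sum_mul]
  rw [kl_mz_sum_char χ hχ, zero_mul, mul_zero] at key
  exact key

end Summit.HubbardSuperconductivity.HubbardSuperconductivity.Theorems

end
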